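import Summits.FinalStateConjecture.FinalStateConjecture.Theses.KerrnessPropagates
import Summits.FinalStateConjecture.FinalStateConjecture.Theorems.KerrnessPropagatesKerrBasinCaptureDefs
import Summits.FinalStateConjecture.FinalStateConjecture.Theorems.KerrnessPropagatesKerrBasinCaptureStubTransferChart
import Summits.FinalStateConjecture.FinalStateConjecture.Theorems.KerrnessPropagatesKerrBasinCaptureStubOrientationTransport
import Summits.FinalStateConjecture.FinalStateConjecture.Theorems.KerrnessPropagatesKerrBasinCaptureStubLargeNearZones
import Summits.FinalStateConjecture.FinalStateConjecture.Theorems.KerrnessPropagatesKerrBasinCaptureStubReanchorMapExists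
import Literature.Geometry.Lorentzian.ReanchoredKerrPullback
import Literature.Geometry.Lorentzian.NearFlatOrientation
import Literature.Geometry.Lorentzian.MultiCentreRadiationZone
import Literature.Geometry.Lorentzian.KerrWaveEnergy

/-!
# Route `KerrnessPropagates`, crux `KerrBasinCapture` (stmt-FinalStateConjecture-17646), line `registered`
# (skeleton `Cruxes/KerrBasinCapture/Lines/birth.lean`, lead rev 7) — stub `stub_slabTransferAtTime`

**Slab transfer at a fixed late time.** The pointwise half of the slab-transfer step of the line:
a hand-over slab `(R, U, Φ)` of accuracy `ε` at lab time `τ` for the multi-Kerr configuration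
`n = (Mₙ, aₙ, r₀ₙ, moₙ)` is turned into a hand-over slab of accuracy `ε'` at the same lab time for a
nearby ("limit") configuration `l = (Mₗ, aₗ, r₀ₗ, moₗ)`, by precomposing the chart with the global
re-anchoring map `Θ` of `stub_reanchorMapShear` (here an INPUT, together with its `C^{k+1}`-closeness
to the identity on the slab `{|x⁰ − τ| < 1}` and its affine Poincaré form with shear frames
`T j = (id + φ j ⊗ ∂₀) ∘ Λₗⱼ⁻¹` on the lab balls of radius `ϱ` about the limit holes). All
smallness / largeness facts that the sequential assembly (`stub_slabTransferCore3`) extracts from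
the registered antecedents enter as explicit hypotheses: wide near zones `R j ≥ R̄ + 3` (T2a),
far-field flatness of the given slab in `Cᵏ` at radii `≥ R̄ − 1` (B), flat preconnected paths to the
far zone (C1), `Cᵏ`-closeness `δc` of the re-anchored Kerr–Schild family on the shells
`μ ≤ rₗⱼ ≤ R̄ + 1` (T2c), closeness of the two configurations (spins, inner radii, lab positions)
and largeness of `ϱ`.

Proof. RADIUS BOOKKEEPING (`transfer_bookkeeping`): on the lab ball of hole `j` the rest-frame
position of `Θ x` for the `n`-th motion is the limit rest-frame position of `x` sheared in time, so
its Kerr–Schild radius is the `aₙⱼ`-radius of the same point (`Kerr.radius_add_time_smul_basisVector`)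
and differs from the limit radius by the spin mismatch only; off the balls every hole is lab-far,
hence far in its rest frame (`le_radius_of_le_norm_spatial_sub`). CHART: `stub_transferChart`
supplies `U'`, `θ`, the chain rule and the tensor transformation law of the deviation. NEAR JETS:
`norm_iteratedFDeriv_reanchor_near_le` (re-anchoring identity + near-identity pullback estimate).
FAR JETS: `norm_iteratedFDeriv_bilinPullback_add_const_sub_le`. ORIENTATION: C1 + B (order `0`) +
`stub_orientationTransport` give `Φ_*∂₀` future-directed at `Θ x`, and
`Spacetime.isFutureDirected_mfderiv_of_norm_deviation_le` tilts `∂₀` to `DΘ ∂₀`. [folklore]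
-/

open scoped BigOperators Topology Manifold Classical Matrix InnerProductSpace ContinuousMap
open Filter Set Function TopologicalSpace
open Literature.Geometry.Lorentzian

-- D-0017: single-problem summit, `Summit.<S>.<S>.…` by design.
set_option linter.dupNamespace false

namespace Summit.FinalStateConjecture.FinalStateConjecture.Theorems.KerrnessPropagates.KerrBasinCapture

open Summit.FinalStateConjecture.FinalStateConjecture.Theorems

/-! ### Extraction from `Cᵏ` sup norms -/

/-- All jets of order `≤ k` of `f` at a point of `S` are bounded by `ε` once
`supCkENorm S k f ≤ ofReal ε` (`enorm_iteratedFDeriv_le_supCkENorm`). [folklore] -/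
theorem norm_iteratedFDeriv_le_of_supCkENorm_ofReal {G : Type*} [NormedAddCommGroup G]
    [NormedSpace ℝ G] {S : Set E4} {k : ℕ} {f : E4 → G} {ε : ℝ} (hε : 0 ≤ ε)
    (h : supCkENorm S k f ≤ ENNReal.ofReal ε) {x : E4} (hx : x ∈ S) :
    ∀ m ≤ k, ‖iteratedFDeriv ℝ m f x‖ ≤ ε := fun m hm ↦ by
  have h1 := (enorm_iteratedFDeriv_le_supCkENorm hm hx f).trans h
  rwa [← ofReal_norm, ENNReal.ofReal_le_ofReal_iff hε] at h1

/-! ### Radius bookkeeping for the re-anchoring map -/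

/-- **Radius bookkeeping for the re-anchoring map.** Let `Θ` preserve lab time, move points of the
slab `{|x⁰ − τ| < 1}` by at most `ηϱ ≤ ϱ/8`, and on the lab ball of radius `ϱ` about the limit hole
`j` have `n`-th rest-frame value `Λₙⱼ⁻¹(Θ x − cₙⱼ) = T j (x − cₗⱼ) + βⱼ ∂₀` with a SHEAR frame
`T j = (id + φ j ⊗ ∂₀) ∘ Λₗⱼ⁻¹` (same spatial part as `Λₗⱼ⁻¹`); let the lab positions of the two
configurations at lab time `τ` be `ϱ/8`-close, the spins `≤ A`, the radii painted with the two spins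
`min(μ/8, 1)`-close on `{r ≥ μ}`, the inner radii related by `μ ≤ r₀ₙ ≤ r₀ₗ − μ/4`, `r₀ + 2 ≤ R̄`,
and `ϱ ≥ 2(R̄ + A + 3)`. Then for every point `x` of the limit punctured hyperplane
`{x⁰ = τ, rₗⱼ > r₀ₗ j}`: (i) `Θ x` lies in the `n`-th punctured hyperplane; (ii) if
`rₗⱼ(x) ≤ R̄ + 1` then `x` is in the OPEN lab ball of hole `j` and `rₙⱼ(Θ x) ≤ R̄ + 2`; (iii) if all
`rₗᵢ(x) ≥ R̄` then all `rₙᵢ(Θ x) ≥ R̄ − 1`. (Case analysis: inside the ball of hole `i` the two radii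
are those of one rest-frame point painted with two spins; outside it, hole `i` of configuration `n`
is at lab distance `≥ 3ϱ/4` from `Θ x`, hence at rest-frame radius `≥ 3ϱ/4 − A ≥ R̄ + 3`,
`le_radius_of_le_norm_spatial_sub`.) [folklore] -/
theorem transfer_bookkeeping {N : ℕ} {μ A Rb ϱ η τ : ℝ} {aₙ r₀ₙ aₗ r₀ₗ : Fin N → ℝ}
    {moₙ moₗ : Fin N → ↥lorentzGroup × E4} {Θ : E4 → E4} {β : Fin N → ℝ}
    {T : Fin N → E4 →L[ℝ] E4} {φ : Fin N → E4 →L[ℝ] ℝ} {Xₙ Xₗ : Fin N → E3}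
    (hμ : 0 < μ) (hA : 0 ≤ A) (hRb : 2 ≤ Rb)
    (hcfg : ∀ i, μ ≤ r₀ₙ i ∧ r₀ₙ i + μ / 4 ≤ r₀ₗ i ∧ r₀ₙ i + 2 ≤ Rb ∧ r₀ₗ i + 2 ≤ Rb ∧
      |aₙ i| ≤ A ∧ |aₗ i| ≤ A)
    (hspin : ∀ i (y : E4), μ ≤ Kerr.radius (aₗ i) y →
      |Kerr.radius (aₙ i) y - Kerr.radius (aₗ i) y| ≤ min (μ / 8) 1)
    (hϱ : 2 * (Rb + A + 3) ≤ ϱ) (hη : η ≤ 1 / 8)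
    (hXₙ : ∀ j, Xₙ j = E4.spatial (moₙ j).2 + (τ - (moₙ j).2 0) • ((((moₙ j).1 : E4 ≃L[ℝ] E4) (E4.basisVector 0) 0)⁻¹ • E4.spatial (((moₙ j).1 : E4 ≃L[ℝ] E4) (E4.basisVector 0))))
    (hXₗ : ∀ j, Xₗ j = E4.spatial (moₗ j).2 + (τ - (moₗ j).2 0) • ((((moₗ j).1 : E4 ≃L[ℝ] E4) (E4.basisVector 0) 0)⁻¹ • E4.spatial (((moₗ j).1 : E4 ≃L[ℝ] E4) (E4.basisVector 0))))
    (hoff : ∀ j, ‖Xₙ j - Xₗ j‖ ≤ ϱ / 8)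
    (hT : ∀ j, T j = (ContinuousLinearMap.id ℝ E4 + (φ j).smulRight (E4.basisVector 0)).comp ((((moₗ j).1 : E4 ≃L[ℝ] E4).symm : E4 →L[ℝ] E4)))
    (hΘt : ∀ x, (Θ x) 0 = x 0) (hΘb : ∀ x : E4, |x 0 - τ| < 1 → ‖Θ x - x‖ ≤ η * ϱ)
    (hΘloc : ∀ j, ∀ x : E4, |x 0 - τ| < 1 → ‖E4.spatial x - Xₗ j‖ ≤ ϱ →
      poincareInv (moₙ j).1 (moₙ j).2 (Θ x) = T j (x - (moₗ j).2) + β j • E4.basisVector 0)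
    {x : E4} (hx0 : x 0 = τ) (hxr : ∀ j, r₀ₗ j < Kerr.radius (aₗ j) (poincareInv (moₗ j).1 (moₗ j).2 x)) :
    (∀ i, r₀ₙ i < Kerr.radius (aₙ i) (poincareInv (moₙ i).1 (moₙ i).2 (Θ x))) ∧
    (∀ j, Kerr.radius (aₗ j) (poincareInv (moₗ j).1 (moₗ j).2 x) ≤ Rb + 1 →
      ‖E4.spatial x - Xₗ j‖ < ϱ ∧ Kerr.radius (aₙ j) (poincareInv (moₙ j).1 (moₙ j).2 (Θ x)) ≤ Rb + 2) ∧
    ((∀ i, Rb ≤ Kerr.radius (aₗ i) (poincareInv (moₗ i).1 (moₗ i).2 x)) → ∀ i, Rb - 1 ≤ Kerr.radius (aₙ i) (poincareInv (moₙ i).1 (moₙ i).2 (Θ x))) := by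
  -- the lab centres of all holes at lab time `τ`
  choose pₗ hpₗ0 hpₗσ hpₗs using fun i ↦ exists_centre (moₗ i).1 (moₗ i).2 τ
  choose pₙ hpₙ0 hpₙσ hpₙs using fun i ↦ exists_centre (moₙ i).1 (moₙ i).2 τ
  have hpₗX : ∀ i, E4.spatial (pₗ i) = Xₗ i := fun i ↦ by rw [hpₗs, hXₗ]
  have hpₙX : ∀ i, E4.spatial (pₙ i) = Xₙ i := fun i ↦ by rw [hpₙs, hXₙ]
  -- re-centring a Poincaré map on its own worldline is a rest-frame time translation
  have hradₙ : ∀ i (y : E4), Kerr.radius (aₙ i) (poincareInv (moₙ i).1 (pₙ i) y) =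
      Kerr.radius (aₙ i) (poincareInv (moₙ i).1 (moₙ i).2 y) := fun i y ↦ by
    obtain ⟨σ, hσ⟩ := hpₙσ i
    rw [poincareInv_eq_sub (moₙ i).1 (moₙ i).2 (pₙ i) y, hσ, sub_eq_add_neg, ← neg_smul,
      Kerr.radius_add_time_smul_basisVector]
  have hsnₗ : ∀ i (y : E4), E4.spatialNorm (poincareInv (moₗ i).1 (pₗ i) y) =
      E4.spatialNorm (poincareInv (moₗ i).1 (moₗ i).2 y) := fun i y ↦ by
    obtain ⟨σ, hσ⟩ := hpₗσ i
    rw [poincareInv_eq_sub (moₗ i).1 (moₗ i).2 (pₗ i) y, hσ, sub_eq_add_neg, ← neg_smul]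
    simp only [E4.spatialNorm, Kerr.spatial_add_smul_basisVector_zero]
  -- basic facts at `x`
  have hslab : |x 0 - τ| < 1 := by rw [hx0, sub_self, abs_zero]; exact one_pos
  have hΘ0 : (Θ x) 0 = τ := (hΘt x).trans hx0
  have hϱ0 : 0 ≤ ϱ := by linarith
  have hmove : ‖E4.spatial (Θ x) - E4.spatial x‖ ≤ ϱ / 8 := by
    rw [← map_sub]
    calc ‖E4.spatial (Θ x - x)‖ ≤ ‖E4.spatial‖ * ‖Θ x - x‖ := E4.spatial.le_opNorm _
      _ ≤ 1 * (η * ϱ) := mul_le_mul rme_norm_spatial_le (hΘb x hslab) (norm_nonneg _) zero_le_one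
      _ ≤ ϱ / 8 := by nlinarith
  -- (D1) lab distance to the limit hole `i` is at most `rₗᵢ(x) + A`
  have hD1 : ∀ i, ‖E4.spatial x - Xₗ i‖ ≤ Kerr.radius (aₗ i) (poincareInv (moₗ i).1 (moₗ i).2 x) + A := by
    intro i
    have h1 := norm_spatial_sub_le (moₗ i).1 (x := x) (p := pₗ i) (by rw [hx0, hpₗ0])
    rw [hpₗX, hsnₗ] at h1
    -- `‖y⃗‖ ≤ r_a(y) + |a|` (`Kerr.spatialNorm_sq_sub_sq_le_radius_sq`)
    have h2 : ∀ (a' : ℝ) (y : E4), E4.spatialNorm y ≤ Kerr.radius a' y + |a'| := fun a' y ↦ by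
      have h := Kerr.spatialNorm_sq_sub_sq_le_radius_sq a' y
      have hr := Kerr.radius_nonneg a' y
      have h3 : E4.spatialNorm y ^ 2 ≤ (Kerr.radius a' y + |a'|) ^ 2 := by
        nlinarith [sq_abs a', mul_nonneg hr (abs_nonneg a')]
      exact (pow_le_pow_iff_left₀ (E4.spatialNorm_nonneg y) (by positivity) two_ne_zero).mp h3
    linarith [(hcfg i).2.2.2.2.2, h2 (aₗ i) (poincareInv (moₗ i).1 (moₗ i).2 x)]
  -- (D2) lab-far from hole `i` of configuration `n` forces a large `n`-radius of `Θ x`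
  have hD2 : ∀ i (t : ℝ), 0 ≤ t → t + A ≤ ‖E4.spatial x - Xₗ i‖ - ϱ / 4 →
      t ≤ Kerr.radius (aₙ i) (poincareInv (moₙ i).1 (moₙ i).2 (Θ x)) := by
    intro i t ht hfar
    rw [← hradₙ i (Θ x)]
    refine le_radius_of_le_norm_spatial_sub (moₙ i).1 (aₙ i) (by rw [hΘ0, hpₙ0]) ht ?_
    rw [hpₙX]
    have h1 := norm_sub_le_norm_sub_add_norm_sub (E4.spatial x) (E4.spatial (Θ x)) (Xₗ i)
    have h2 := norm_sub_le_norm_sub_add_norm_sub (E4.spatial (Θ x)) (Xₙ i) (Xₗ i)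
    rw [norm_sub_rev] at hmove
    linarith [(hcfg i).2.2.2.2.1, hoff i]
  -- (E) on the lab ball of hole `j`, the `n`-radius of `Θ x` is the `aₙⱼ`-radius of the limit
  -- rest-frame point, hence `min(μ/8, 1)`-close to the limit radius
  have hE : ∀ j, ‖E4.spatial x - Xₗ j‖ ≤ ϱ →
      |Kerr.radius (aₙ j) (poincareInv (moₙ j).1 (moₙ j).2 (Θ x)) - Kerr.radius (aₗ j) (poincareInv (moₗ j).1 (moₗ j).2 x)| ≤ min (μ / 8) 1 := by
    intro j hj
    have e : T j (x - (moₗ j).2) = poincareInv (moₗ j).1 (moₗ j).2 x +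
        (φ j (poincareInv (moₗ j).1 (moₗ j).2 x)) • E4.basisVector 0 := by
      rw [hT j]
      simp [poincareInv]
    rw [hΘloc j x hslab hj, Kerr.radius_add_time_smul_basisVector, e,
      Kerr.radius_add_time_smul_basisVector]
    refine hspin j _ ?_
    linarith [hxr j, (hcfg j).1, (hcfg j).2.1]
  refine ⟨fun i ↦ ?_, fun j hj ↦ ?_, fun hfar i ↦ ?_⟩
  · by_cases hb : ‖E4.spatial x - Xₗ i‖ ≤ ϱ
    · have h := abs_le.mp ((hE i hb).trans (min_le_left _ _))
      linarith [hxr i, (hcfg i).2.1]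
    · push Not at hb
      have h := hD2 i (3 * ϱ / 4 - A) (by linarith) (by linarith)
      linarith [(hcfg i).2.2.1]
  · have hd : ‖E4.spatial x - Xₗ j‖ < ϱ := by linarith [hD1 j]
    have h := abs_le.mp ((hE j hd.le).trans (min_le_right _ _))
    exact ⟨hd, by linarith⟩
  · by_cases hb : ‖E4.spatial x - Xₗ i‖ ≤ ϱ
    · have h := abs_le.mp ((hE i hb).trans (min_le_right _ _))
      linarith [hfar i]
    · push Not at hb
      have h := hD2 i (3 * ϱ / 4 - A) (by linarith) (by linarith)
      linarith

/-! ### The stub -/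

/-- stub_slabTransferAtTime — **SLAB TRANSFER AT A FIXED LATE TIME** (intermediate registered stub
of crux stmt-FinalStateConjecture-17646, line `registered`): given the re-anchoring map `Θ` with its
shear frames, the wide-near-zone, far-flatness, flat-path and family-continuity facts at this lab
time, and the closeness of the two configurations, a hand-over slab of accuracy `ε` for
configuration `n` at lab time `τ` yields a hand-over slab of accuracy `ε'` for the limit
configuration at the same lab time (`R' j = R̄ + 1`, `U'` and `Φ ∘ θ` from `stub_transferChart`).
[folklore] -/
theorem slabTransferAtTime_expanded : ∀ k : ℕ, ∀ (X : Type) [TopologicalSpace X] [ChartedSpace E3 X] [IsManifold (𝓡 3) (⊤ : ℕ∞) X] [T2Space X] [SecondCountableTopology X] [ConnectedSpace X] (D : InitialDataSet (𝓡 3) X) (𝒟 : VacuumCauchyDevelopment D) (N : ℕ) (μ A : ℝ) (Mₙ aₙ r₀ₙ : Fin N → ℝ) (moₙ : Fin N → ↥lorentzGroup × E4) (Mₗ aₗ r₀ₗ : Fin N → ℝ) (moₗ : Fin N → ↥lorentzGroup × E4) (τ ε ε' Rb ϱ η δc f₀ : ℝ) (Θ : E4 → E4) (β : Fin N → ℝ)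 (T : Fin N → E4 →L[ℝ] E4) (φ : Fin N → E4 →L[ℝ] ℝ) (Xₙ Xₗ : Fin N → E3) (R : Fin N → ℝ) (U : Opens E4) (Φ : U → 𝒟.carrier), 0 < μ → 0 ≤ A → 2 ≤ Rb → (∀ i, μ ≤ r₀ₙ i ∧ r₀ₙ i + μ / 4 ≤ r₀ₗ i ∧ r₀ₙ i + 2 ≤ Rb ∧ r₀ₗ i + 2 ≤ Rb ∧ |aₙ i| ≤ A ∧ |aₗ i| ≤ A) → (∀ i (y : E4), μ ≤ Kerr.radius (aₗ i) y → |Kerr.radius (aₙ i) y - Kerr.radius (aₗ i) y| ≤ min (μ / 8) 1) → 2 * (Rb + A + 3) ≤ ϱ → 0 < ε → 0 ≤ η → η ≤ 1 / 8 → 0 ≤ f₀ → f₀ ≤ 1 / 8 → 4 ^ k * (k.factorial : ℝ) * 2 ^ (k + 2) * ε + δc ≤ ε' → 4 ^ k * (k.factorial : ℝ) * 2 ^ (k + 2) * f₀ + 2 ^ (k + 2) * ‖Minkowski.bilin‖ * η ≤ ε' → (∀ j, Xₙ j = E4.spatial (moₙ j).2 + (τ - (moₙ j).2 0) • ((((moₙ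 j).1 : E4 ≃L[ℝ] E4) (E4.basisVector 0) 0)⁻¹ • E4.spatial (((moₙ j).1 : E4 ≃L[ℝ] E4) (E4.basisVector 0)))) → (∀ j, Xₗ j = E4.spatial (moₗ j).2 + (τ - (moₗ j).2 0) • ((((moₗ j).1 : E4 ≃L[ℝ] E4) (E4.basisVector 0) 0)⁻¹ • E4.spatial (((moₗ j).1 : E4 ≃L[ℝ] E4) (E4.basisVector 0)))) → (∀ j, ‖Xₙ j - Xₗ j‖ ≤ ϱ / 8) → (∀ j, T j = (ContinuousLinearMap.id ℝ E4 + (φ j).smulRight (E4.basisVector 0)).comp ((((moₗ j).1 : E4 ≃L[ℝ] E4).symm : E4 →L[ℝ] E4))) → ContDiff ℝ (⊤ : ℕ∞) Θ → (∀ x, (Θ x) 0 = x 0) → (∀ x : E4, |x 0 - τ| < 1 → ‖fderiv ℝ Θ x - ContinuousLinearMap.id ℝ E4‖ ≤ η ∧ ‖Θ x - x‖ ≤ η * ϱ ∧ ∀ m : ℕ, 2 ≤ m → m ≤ k + 1 → ‖iteratedFDeriv ℝ m Θ x‖ ≤ η) → Topology.IsOpenEmbedding ({x : E4 | |x 0 -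 τ| < 1}.restrict Θ) → (∀ j, ∀ x : E4, |x 0 - τ| < 1 → ‖E4.spatial x - Xₗ j‖ ≤ ϱ → fderiv ℝ Θ x = (((moₙ j).1 : E4 ≃L[ℝ] E4) : E4 →L[ℝ] E4).comp (T j) ∧ poincareInv (moₙ j).1 (moₙ j).2 (Θ x) = T j (x - (moₗ j).2) + β j • E4.basisVector 0) → (∀ j, ∀ i ≤ k, ∀ x : E4, μ ≤ Kerr.radius (aₗ j) (poincareInv (moₗ j).1 (moₗ j).2 x) → Kerr.radius (aₗ j) (poincareInv (moₗ j).1 (moₗ j).2 x) ≤ Rb + 1 → ‖iteratedFDeriv ℝ i (fun z ↦ (ContinuousLinearMap.precomp ℝ (T j)).comp ((Kerr.bilin (Mₙ j) (aₙ j) (T j (z - (moₗ j).2))).comp (T j))) x - iteratedFDeriv ℝ i (boostedKerrBilin (moₗ j).1 (moₗ j).2 (Mₗ j) (aₗ j)) x‖ ≤ δc) → ((∀ i, r₀ₙ i + 1 ≤ R i) ∧ ContMDiff 𝓘(ℝ, E4) (𝓡 4) (⊤ : ℕ∞) Φ ∧ Topology.IsOpenEmbedding Φ ∧ {x : E4 |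 x 0 = τ ∧ (∀ j, r₀ₙ j < Kerr.radius (aₙ j) (poincareInv (moₙ j).1 (moₙ j).2 x))} ⊆ (U : Set E4) ∧ range Φ ⊆ 𝒟.metric.causalFuture 𝒟.timeOrientation (range 𝒟.embed) ∧ 𝒟.metric.IsAchronal 𝒟.timeOrientation (Φ '' {x : ↥U | (x : E4) 0 = τ}) ∧ (∀ i, supCkENorm {x : E4 | x 0 = τ ∧ (∀ j, r₀ₙ j < Kerr.radius (aₙ j) (poincareInv (moₙ j).1 (moₙ j).2 x)) ∧ Kerr.radius (aₙ i) (poincareInv (moₙ i).1 (moₙ i).2 x) ≤ R i} k (𝒟.toSpacetime.deviationExtend ⟨U, boostedKerrBilin (moₙ i).1 (moₙ i).2 (Mₙ i) (aₙ i), fun x ↦ x 0, fun x ↦ Kerr.radius (aₙ i) (poincareInv (moₙ i).1 (moₙ i).2 x)⟩ Φ) ≤ ENNReal.ofReal ε) ∧ supCkENorm {x : E4 | x 0 = τ ∧ (∀ j, r₀ₙ j < Kerr.radius (aₙ j) (poincareInv (moₙ j).1 (moₙ j).2 x)) ∧ ∀ j, R j - 1 ≤ Kerr.radius (aₙ j)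 (poincareInv (moₙ j).1 (moₙ j).2 x)} k (𝒟.toSpacetime.deviationExtend (Minkowski.backgroundOn U) Φ) ≤ ENNReal.ofReal ε ∧ (∀ x : ↥U, x.1 0 = τ → (∀ j, R j - 1 ≤ Kerr.radius (aₙ j) (poincareInv (moₙ j).1 (moₙ j).2 x.1)) → 𝒟.timeOrientation.IsFutureDirected (mfderiv 𝓘(ℝ, E4) (𝓡 4) Φ x (E4.basisVector 0)))) → (∀ j, Rb + 3 ≤ R j) → (∀ z : E4, z 0 = τ → (∀ l, r₀ₙ l < Kerr.radius (aₙ l) (poincareInv (moₙ l).1 (moₙ l).2 z)) → (∀ l, Rb - 1 ≤ Kerr.radius (aₙ l) (poincareInv (moₙ l).1 (moₙ l).2 z)) → ∀ m ≤ k, ‖iteratedFDeriv ℝ m (𝒟.toSpacetime.deviationExtend (Minkowski.backgroundOn U) Φ) z‖ ≤ f₀) → (∀ z : E4, z 0 = τ → (∀ i, Rb - 1 ≤ Kerr.radius (aₙ i) (poincareInv (moₙ i).1 (moₙ i).2 z)) → ∃ S : Set E4, IsPreconnected S ∧ z ∈ S ∧ (∀ x ∈ S, x 0 = τ ∧ ∀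 i, Rb - 1 ≤ Kerr.radius (aₙ i) (poincareInv (moₙ i).1 (moₙ i).2 x)) ∧ ∃ z₂ ∈ S, ∀ i, R i ≤ Kerr.radius (aₙ i) (poincareInv (moₙ i).1 (moₙ i).2 z₂)) → ∃ (R : Fin N → ℝ) (U : Opens E4) (Φ : U → 𝒟.carrier), (∀ i, r₀ₗ i + 1 ≤ R i) ∧ ContMDiff 𝓘(ℝ, E4) (𝓡 4) (⊤ : ℕ∞) Φ ∧ Topology.IsOpenEmbedding Φ ∧ {x : E4 | x 0 = τ ∧ (∀ j, r₀ₗ j < Kerr.radius (aₗ j) (poincareInv (moₗ j).1 (moₗ j).2 x))} ⊆ (U : Set E4) ∧ range Φ ⊆ 𝒟.metric.causalFuture 𝒟.timeOrientation (range 𝒟.embed) ∧ 𝒟.metric.IsAchronal 𝒟.timeOrientation (Φ '' {x : ↥U | (x : E4) 0 = τ}) ∧ (∀ i, supCkENorm {x : E4 | x 0 = τ ∧ (∀ j, r₀ₗ j < Kerr.radius (aₗ j) (poincareInv (moₗ j).1 (moₗ j).2 x)) ∧ Kerr.radius (aₗ i) (poincareInv (moₗ i).1 (moₗ i).2 x)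 ≤ R i} k (𝒟.toSpacetime.deviationExtend ⟨U, boostedKerrBilin (moₗ i).1 (moₗ i).2 (Mₗ i) (aₗ i), fun x ↦ x 0, fun x ↦ Kerr.radius (aₗ i) (poincareInv (moₗ i).1 (moₗ i).2 x)⟩ Φ) ≤ ENNReal.ofReal ε') ∧ supCkENorm {x : E4 | x 0 = τ ∧ (∀ j, r₀ₗ j < Kerr.radius (aₗ j) (poincareInv (moₗ j).1 (moₗ j).2 x)) ∧ ∀ j, R j - 1 ≤ Kerr.radius (aₗ j) (poincareInv (moₗ j).1 (moₗ j).2 x)} k (𝒟.toSpacetime.deviationExtend (Minkowski.backgroundOn U) Φ) ≤ ENNReal.ofReal ε' ∧ (∀ x : ↥U, x.1 0 = τ → (∀ j, R j - 1 ≤ Kerr.radius (aₗ j) (poincareInv (moₗ j).1 (moₗ j).2 x.1)) → 𝒟.timeOrientation.IsFutureDirected (mfderiv 𝓘(ℝ, E4) (𝓡 4) Φ x (E4.basisVector 0))) := by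
  intro k X _ _ _ _ _ _ D 𝒟 N μ A Mₙ aₙ r₀ₙ moₙ Mₗ aₗ r₀ₗ moₗ τ ε ε' Rb ϱ η δc f₀ Θ β T φ Xₙ Xₗ R U Φ
    hμ hA hRb hcfg hspin hϱ hε hη0 hη hf₀0 hf₀ hnum1 hnum2 hXₙ hXₗ hoff hT hΘs hΘt hΘb hΘe hΘloc
    hT2c hslab hR hB hC1
  have hs := hslab
  obtain ⟨-, hΦ, hemb, hU, hJ, hachr, hnear, -, -⟩ := hs
  have hη1 : η ≤ 1 := by linarith
  have hbk := fun (x : E4) (hx0 : x 0 = τ)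
      (hxr : ∀ j, r₀ₗ j < Kerr.radius (aₗ j) (poincareInv (moₗ j).1 (moₗ j).2 x)) ↦
    transfer_bookkeeping (Θ := Θ) (β := β) hμ hA hRb hcfg hspin hϱ hη hXₙ hXₗ hoff hT hΘt
      (fun y hy ↦ (hΘb y hy).2.1) (fun j y hy hyj ↦ (hΘloc j y hy hyj).2) hx0 hxr
  -- the transferred chart
  obtain ⟨U', θ, hU'eq, hθval, hΦ', hemb', hcont', hJ', hachr', hchain, hdev⟩ :=
    stub_transferChart k X D 𝒟 N aₙ r₀ₙ moₙ aₗ r₀ₗ moₗ τ U Φ Θ hΦ hemb hU hJ hachr hΘs hΘt hΘe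
      (fun x hx0 hxr ↦ (hbk x hx0 hxr).1)
  have hslabO : IsOpen {x : E4 | |x 0 - τ| < 1} :=
    isOpen_lt ((PiLp.continuous_apply 2 _ 0).sub continuous_const).abs continuous_const
  have hΘk : ∀ s : Set E4, ContDiffOn ℝ (k + 1) Θ s := fun s ↦
    (hΘs.of_le (by exact_mod_cast le_top)).contDiffOn
  refine ⟨fun _ ↦ Rb + 1, U', Φ ∘ θ, fun i ↦ by linarith [(hcfg i).2.2.2.1], hΦ', hemb', hcont',
    hJ', hachr', fun i ↦ ?_, ?_, fun x hx0 hxR ↦ ?_⟩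
  · -- NEAR JETS of hole `i`
    refine supCkENorm_le_ofReal fun m hm x hx ↦ ?_
    obtain ⟨hx0, hxr, hxi⟩ := hx
    obtain ⟨hmaps, hnear', -⟩ := hbk x hx0 hxr
    obtain ⟨hball, hRi⟩ := hnear' i hxi
    have hxU' : x ∈ (U' : Set E4) := hcont' ⟨hx0, hxr⟩
    have hslabx : |x 0 - τ| < 1 := by rw [hx0, sub_self, abs_zero]; exact one_pos
    have hΘ0 : (Θ x) 0 = τ := (hΘt x).trans hx0
    have hΘU : Θ x ∈ (U : Set E4) := hU ⟨hΘ0, hmaps⟩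
    have hposₙ : 0 < Kerr.radius (aₙ i) (poincareInv (moₙ i).1 (moₙ i).2 (Θ x)) := (hμ.trans_le (hcfg i).1).trans (hmaps i)
    have hposₗ : 0 < Kerr.radius (aₗ i) (poincareInv (moₗ i).1 (moₗ i).2 x) := by linarith [hxr i, (hcfg i).1, (hcfg i).2.1]
    -- the deviation identity of the transferred chart near `x`
    have hdx := hdev (boostedKerrBilin (moₙ i).1 (moₙ i).2 (Mₙ i) (aₙ i))
      (boostedKerrBilin (moₗ i).1 (moₗ i).2 (Mₗ i) (aₗ i)) (fun x ↦ x 0) (fun x ↦ x 0)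
      (fun x ↦ Kerr.radius (aₙ i) (poincareInv (moₙ i).1 (moₙ i).2 x)) (fun x ↦ Kerr.radius (aₗ i) (poincareInv (moₗ i).1 (moₗ i).2 x)) ⟨x, hxU'⟩
    rw [(hdx.iteratedFDeriv ℝ m).eq_of_nhds]
    -- smoothness domains: `t = U ∩ {rₙᵢ > 0}`, `s = slab ∩ Θ⁻¹ t`
    set t : Set E4 := (U : Set E4) ∩ {z : E4 | 0 < Kerr.radius (aₙ i) (poincareInv (moₙ i).1 (moₙ i).2 z)} with ht_def
    have ht : IsOpen t := U.isOpen.inter (isOpen_setOf_radius_poincareInv_pos _ _ _)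
    have hFt : ContDiffOn ℝ k (𝒟.toSpacetime.deviationExtend ⟨U, boostedKerrBilin (moₙ i).1
        (moₙ i).2 (Mₙ i) (aₙ i), fun x ↦ x 0, fun x ↦ Kerr.radius (aₙ i) (poincareInv (moₙ i).1 (moₙ i).2 x)⟩ Φ) t := fun z hz ↦
      ((𝒟.toSpacetime.contDiffAt_deviationExtend_model ⟨U, boostedKerrBilin (moₙ i).1 (moₙ i).2
        (Mₙ i) (aₙ i), fun x ↦ x 0, fun x ↦ Kerr.radius (aₙ i) (poincareInv (moₙ i).1 (moₙ i).2 x)⟩ hΦ ⟨z, hz.1⟩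
        (contDiffAt_boostedKerrBilin _ _ _ _ hz.2)).of_le (by exact_mod_cast le_top)).contDiffWithinAt
    set s : Set E4 := {y : E4 | |y 0 - τ| < 1} ∩ Θ ⁻¹' t with hs_def
    have hs : IsOpen s := hslabO.inter (ht.preimage hΘs.continuous)
    have hxs : x ∈ s := ⟨hslabx, hΘU, hposₙ⟩
    -- jets of the hypothesis deviation at `Θ x ∈ Nearₙᵢ`
    have hFb := norm_iteratedFDeriv_le_of_supCkENorm_ofReal hε.le (hnear i)
      (x := Θ x) ⟨hΘ0, hmaps, hRi.trans (by linarith [hR i])⟩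
    -- the affine structure of `Θ` near `x`
    have hloc : ∀ᶠ y in 𝓝 x, fderiv ℝ Θ y = (((moₙ i).1 : E4 ≃L[ℝ] E4) : E4 →L[ℝ] E4).comp (T i) ∧
        poincareInv (moₙ i).1 (moₙ i).2 (Θ y) = T i (y - (moₗ i).2) + β i • E4.basisVector 0 := by
      have h2 : IsOpen {y : E4 | ‖E4.spatial y - Xₗ i‖ < ϱ} :=
        isOpen_lt (by fun_prop) continuous_const
      filter_upwards [hslabO.mem_nhds hslabx, h2.mem_nhds hball] with y hy1 hy2
        using hΘloc i y hy1 hy2.le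
    obtain ⟨hd1, -, hd2⟩ := hΘb x hslabx
    exact (norm_iteratedFDeriv_reanchor_near_le (moₙ i).1 (moₗ i).1 (moₙ i).2 (moₗ i).2 (Mₙ i)
      (aₙ i) (Mₗ i) (aₗ i) (T i) (β i) hs ht (hΘk s) hFt (fun y hy ↦ hy.2) hxs hη1 hε.le hd1 hd2
      hFb hloc hposₙ hposₗ (fun j hj ↦ hT2c i j hj x (by linarith [hxr i, (hcfg i).1,
        (hcfg i).2.1]) hxi) hm).trans hnum1
  · -- FAR JETS
    refine supCkENorm_le_ofReal fun m hm x hx ↦ ?_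
    obtain ⟨hx0, hxr, hxR⟩ := hx
    obtain ⟨hmaps, -, hfar'⟩ := hbk x hx0 hxr
    have hfarR := hfar' fun j ↦ by linarith [hxR j]
    have hxU' : x ∈ (U' : Set E4) := hcont' ⟨hx0, hxr⟩
    have hslabx : |x 0 - τ| < 1 := by rw [hx0, sub_self, abs_zero]; exact one_pos
    have hΘ0 : (Θ x) 0 = τ := (hΘt x).trans hx0
    have hΘU : Θ x ∈ (U : Set E4) := hU ⟨hΘ0, hmaps⟩
    have hdx := hdev (fun _ ↦ Minkowski.bilin) (fun _ ↦ Minkowski.bilin) (fun x ↦ x 0)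
      (fun x ↦ x 0) E4.spatialNorm E4.spatialNorm ⟨x, hxU'⟩
    change ‖iteratedFDeriv ℝ m (𝒟.toSpacetime.deviationExtend ⟨U', fun _ ↦ Minkowski.bilin,
      fun x ↦ x 0, E4.spatialNorm⟩ (Φ ∘ θ)) x‖ ≤ ε'
    rw [(hdx.iteratedFDeriv ℝ m).eq_of_nhds]
    have hFt : ContDiffOn ℝ k (𝒟.toSpacetime.deviationExtend ⟨U, fun _ ↦ Minkowski.bilin,
        fun x ↦ x 0, E4.spatialNorm⟩ Φ) (U : Set E4) := fun z hz ↦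
      ((𝒟.toSpacetime.contDiffAt_deviationExtend_model ⟨U, fun _ ↦ Minkowski.bilin, fun x ↦ x 0,
        E4.spatialNorm⟩ hΦ ⟨z, hz⟩ contDiffAt_const).of_le
        (by exact_mod_cast le_top)).contDiffWithinAt
    set s : Set E4 := {y : E4 | |y 0 - τ| < 1} ∩ Θ ⁻¹' (U : Set E4) with hs_def
    have hs : IsOpen s := hslabO.inter (U.isOpen.preimage hΘs.continuous)
    have hxs : x ∈ s := ⟨hslabx, hΘU⟩
    have hFb : ∀ j ≤ k, ‖iteratedFDeriv ℝ j (𝒟.toSpacetime.deviationExtend ⟨U, fun _ ↦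
        Minkowski.bilin, fun x ↦ x 0, E4.spatialNorm⟩ Φ) (Θ x)‖ ≤ f₀ :=
      hB (Θ x) hΘ0 hmaps hfarR
    obtain ⟨hd1, -, hd2⟩ := hΘb x hslabx
    exact (norm_iteratedFDeriv_bilinPullback_add_const_sub_le Minkowski.bilin hs U.isOpen (hΘk s)
      hFt (fun y hy ↦ hy.2) hxs hη0 hη1 hf₀0 hd1 hd2 hFb hm).trans hnum2
  · -- ORIENTATION at a far point of the transferred slab
    have hxU' : (x : E4) ∈ (U' : Set E4) := x.2
    rw [hU'eq] at hxU'
    obtain ⟨⟨hxslab, -⟩, hxr⟩ := hxU'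
    obtain ⟨hmaps, -, hfar'⟩ := hbk x hx0 hxr
    have hfarR := hfar' fun j ↦ by linarith [hxR j]
    have hz0 : (Θ x) 0 = τ := (hΘt x).trans hx0
    rw [hchain x (E4.basisVector 0)]
    -- a flat preconnected path from `Θ x` to the far zone, along which the orientation is transported
    obtain ⟨S, hS, hzS, hSsub, z₂, hz₂S, hz₂R⟩ := hC1 (Θ x) hz0 hfarR
    have hSsl : S ⊆ {y : E4 | y 0 = τ ∧ ∀ j, r₀ₙ j < Kerr.radius (aₙ j) (poincareInv (moₙ j).1 (moₙ j).2 y)} := fun y hy ↦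
      ⟨(hSsub y hy).1, fun j ↦ lt_of_lt_of_le (by linarith [(hcfg j).2.2.1]) ((hSsub y hy).2 j)⟩
    have hflat : ∀ y ∈ S, ‖𝒟.toSpacetime.deviationExtend (Minkowski.backgroundOn U) Φ y‖ < 1 := by
      intro y hy
      have h := hB y (hSsub y hy).1 (hSsl hy).2 (hSsub y hy).2 0 (Nat.zero_le k)
      rw [norm_iteratedFDeriv_zero] at h
      linarith
    have hθx : ((θ x : U) : E4) ∈ S := by rw [hθval]; exact hzS
    have hfd := stub_orientationTransport k X D 𝒟 N Mₙ aₙ r₀ₙ moₙ ε τ R U Φ hslab S hS hSsl hflat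
      ⟨z₂, hz₂S, fun j ↦ by linarith [hz₂R j]⟩ (θ x) hθx
    have hdevz : ‖𝒟.toSpacetime.deviationExtend (Minkowski.backgroundOn U) Φ (θ x)‖ ≤ 1 / 8 := by
      have h := hB (Θ x) hz0 hmaps hfarR 0 (Nat.zero_le k)
      rw [norm_iteratedFDeriv_zero] at h
      rw [hθval]
      linarith
    have hu : ‖fderiv ℝ Θ x (E4.basisVector 0) - E4.basisVector 0‖ ≤ 1 / 8 := by
      obtain ⟨hd1, -, -⟩ := hΘb x hxslab
      have e : fderiv ℝ Θ x (E4.basisVector 0) - E4.basisVector 0 =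
          (fderiv ℝ Θ x - ContinuousLinearMap.id ℝ E4) (E4.basisVector 0) := by simp
      rw [e]
      refine (ContinuousLinearMap.le_opNorm _ _).trans ?_
      rw [show ‖(E4.basisVector 0 : E4)‖ = 1 by simp [E4.basisVector], mul_one]
      exact hd1.trans hη
    exact 𝒟.toSpacetime.isFutureDirected_mfderiv_of_norm_deviation_le Φ (θ x) hfd hdevz hu

/-- stub AtTime — **SLAB TRANSFER AT A FIXED LATE TIME** (registered stub of crux stmt-FinalStateConjecture-17646, line
`registered`, rev 10: the same statement as `slabTransferAtTime_expanded` with the hand-over slab blocks NAMED through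
the line's definitions `SlabWith` / `SlabAt` of `KerrnessPropagatesKerrBasinCaptureDefs` — definitionally equal, so the
proof is the expanded theorem itself). -/
theorem stub_slabTransferAtTime : ∀ k : ℕ, ∀ (X : Type) [TopologicalSpace X] [ChartedSpace E3 X] [IsManifold (𝓡 3) (⊤ : ℕ∞) X] [T2Space X] [SecondCountableTopology X] [ConnectedSpace X] (D : InitialDataSet (𝓡 3) X) (𝒟 : VacuumCauchyDevelopment D) (N : ℕ) (μ A : ℝ) (Mₙ aₙ r₀ₙ : Fin N → ℝ) (moₙ : Fin N → ↥lorentzGroup × E4) (Mₗ aₗ r₀ₗ : Fin N → ℝ) (moₗ : Fin N → ↥lorentzGroup × E4) (τ ε ε' Rb ϱ η δc f₀ : ℝ) (Θ : E4 → E4) (β : Fin N → ℝ) (T : Fin N → E4 →L[ℝ] E4) (φ : Fin N → E4 →L[ℝ] ℝ) (Xₙ Xₗ : Fin N → E3) (R : Fin N → ℝ) (U : Opens E4) (Φ : U → 𝒟.carrier), 0 < μ → 0 ≤ A → 2 ≤ Rb → (∀ i, μ ≤ r₀ₙ i ∧ r₀ₙ i + μ / 4 ≤ r₀ₗ i ∧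 r₀ₙ i + 2 ≤ Rb ∧ r₀ₗ i + 2 ≤ Rb ∧ |aₙ i| ≤ A ∧ |aₗ i| ≤ A) → (∀ i (y : E4), μ ≤ Kerr.radius (aₗ i) y → |Kerr.radius (aₙ i) y - Kerr.radius (aₗ i) y| ≤ min (μ / 8) 1) → 2 * (Rb + A + 3) ≤ ϱ → 0 < ε → 0 ≤ η → η ≤ 1 / 8 → 0 ≤ f₀ → f₀ ≤ 1 / 8 → 4 ^ k * (k.factorial : ℝ) * 2 ^ (k + 2) * ε + δc ≤ ε' → 4 ^ k * (k.factorial : ℝ) * 2 ^ (k + 2) * f₀ + 2 ^ (k + 2) * ‖Minkowski.bilin‖ * η ≤ ε' → (∀ j, Xₙ j = E4.spatial (moₙ j).2 + (τ - (moₙ j).2 0) • ((((moₙ j).1 : E4 ≃L[ℝ] E4) (E4.basisVector 0) 0)⁻¹ • E4.spatial (((moₙ j).1 : E4 ≃L[ℝ] E4) (E4.basisVector 0)))) → (∀ j, Xₗ j = E4.spatial (moₗ j).2 + (τ - (moₗ j).2 0) • ((((moₗ j).1 : E4 ≃L[ℝ] E4) (E4.basisVector 0) 0)⁻¹ • E4.spatial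 (((moₗ j).1 : E4 ≃L[ℝ] E4) (E4.basisVector 0)))) → (∀ j, ‖Xₙ j - Xₗ j‖ ≤ ϱ / 8) → (∀ j, T j = (ContinuousLinearMap.id ℝ E4 + (φ j).smulRight (E4.basisVector 0)).comp ((((moₗ j).1 : E4 ≃L[ℝ] E4).symm : E4 →L[ℝ] E4))) → ContDiff ℝ (⊤ : ℕ∞) Θ → (∀ x, (Θ x) 0 = x 0) → (∀ x : E4, |x 0 - τ| < 1 → ‖fderiv ℝ Θ x - ContinuousLinearMap.id ℝ E4‖ ≤ η ∧ ‖Θ x - x‖ ≤ η * ϱ ∧ ∀ m : ℕ, 2 ≤ m → m ≤ k + 1 → ‖iteratedFDeriv ℝ m Θ x‖ ≤ η) → Topology.IsOpenEmbedding ({x : E4 | |x 0 - τ| < 1}.restrict Θ) → (∀ j, ∀ x : E4, |x 0 - τ| < 1 → ‖E4.spatial x - Xₗ j‖ ≤ ϱ → fderiv ℝ Θ x = (((moₙ j).1 : E4 ≃L[ℝ] E4) : E4 →L[ℝ] E4).comp (T j) ∧ poincareInv (moₙ j).1 (moₙ j).2 (Θ x) = T j (x - (moₗ j).2) + β j • E4.basisVector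 0) → (∀ j, ∀ i ≤ k, ∀ x : E4, μ ≤ Kerr.radius (aₗ j) (poincareInv (moₗ j).1 (moₗ j).2 x) → Kerr.radius (aₗ j) (poincareInv (moₗ j).1 (moₗ j).2 x) ≤ Rb + 1 → ‖iteratedFDeriv ℝ i (fun z ↦ (ContinuousLinearMap.precomp ℝ (T j)).comp ((Kerr.bilin (Mₙ j) (aₙ j) (T j (z - (moₗ j).2))).comp (T j))) x - iteratedFDeriv ℝ i (boostedKerrBilin (moₗ j).1 (moₗ j).2 (Mₗ j) (aₗ j)) x‖ ≤ δc) → SlabWith k 𝒟 N Mₙ aₙ r₀ₙ moₙ ε τ R U Φ → (∀ j, Rb + 3 ≤ R j) → (∀ z : E4, z 0 = τ → (∀ l, r₀ₙ l < Kerr.radius (aₙ l) (poincareInv (moₙ l).1 (moₙ l).2 z)) → (∀ l, Rb - 1 ≤ Kerr.radius (aₙ l) (poincareInv (moₙ l).1 (moₙ l).2 z)) → ∀ m ≤ k, ‖iteratedFDeriv ℝ m (𝒟.toSpacetime.deviationExtend (Minkowski.backgroundOn U) Φ) z‖ ≤ f₀) → (∀ z : E4, z 0 = τ → (∀ i, Rb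 - 1 ≤ Kerr.radius (aₙ i) (poincareInv (moₙ i).1 (moₙ i).2 z)) → ∃ S : Set E4, IsPreconnected S ∧ z ∈ S ∧ (∀ x ∈ S, x 0 = τ ∧ ∀ i, Rb - 1 ≤ Kerr.radius (aₙ i) (poincareInv (moₙ i).1 (moₙ i).2 x)) ∧ ∃ z₂ ∈ S, ∀ i, R i ≤ Kerr.radius (aₙ i) (poincareInv (moₙ i).1 (moₙ i).2 z₂)) → SlabAt k 𝒟 N Mₗ aₗ r₀ₗ moₗ ε' τ :=
  slabTransferAtTime_expanded

end Summit.FinalStateConjecture.FinalStateConjecture.Theorems.KerrnessPropagates.KerrBasinCapture
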